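import Literature.MathematicalPhysics.QuantumFieldTheory.Balaban1983to89.Node00.BgLettersOfRecord
import Literature.MathematicalPhysics.QuantumFieldTheory.Balaban1983to89.B11Eq117ReadLettersBridge

/-!
# The (117) ∕ (103) sockets at the record: fibre-norm constants of `phiRec` and the operator-norm bounds of `frakGOfRecord`, `H1OfRecord`

Bałaban, *Averaging operations for lattice gauge theories*, CMP 98 (1985) [B7], (18)–(19) p.21 (the two normings of `M_N(ℂ)`: the
trace ∕ Hilbert–Schmidt scalar product and the operator norm); *Propagators for lattice gauge theories in a background field*, CMP 99 (1985)
389–434 [B9], Thm 3.1 (3.47) p.398, Thm 3.12 p.423, Thm 3.13 p.426; *The variational problem and background fields*, CMP 102 (1985) [B11],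
(103) p.293, (115)–(117) pp.294–295.

`Node00.BgLettersOfRecord` pinned the letters of (110)–(111) at the record and produced `𝔊(U₀)` ∕ `H₁(U₀)` IN THE TYPE OF (115)
(`frakGOfRecord`, `H1OfRecord`: operators from (115)-normed function spaces with values in `M_N(ℂ)` under the OPERATOR norm (19)), built over
the Hilbert fibre `WRec N = ℂ^{N×N}` (Euclidean = trace norm (18)) through the identification `phiRec N : WRec N ≃ₗ[ℂ] M_N(ℂ)`.
Lit's (117) ∕ (103) SOCKETS (`B11Eq117ReadLettersBridge.norm_frakGLatticeCLM_le_of_global`, `norm_H1LatticeCLM_le_of_global`) turn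
`W`-level global sup → sup letters of the Hilbert-level `𝔊 = frakGLatticeK hpos hQ` ∕ `H₁ = H1LatticeK hpos hQ` (value `B₀`, covariant gradient
`B₁`) into the (115)-operator-norm bounds (117) ∕ (103), at the price of two FIBRE CONSTANTS `M_φ`, `M_φ′` comparing the normings along `φ`.
This file supplies those constants for `phiRec` and states the two sockets AT THE RECORD.

## What is here

* §1 `norm_phiRec_le : ‖phiRec N v‖ ≤ N²·‖v‖`, `norm_phiRec_symm_le : ‖(phiRec N).symm X‖ ≤ N²·‖X‖` — (18) vs (19) with the CRUDE constant
  `N²` both ways (operator norm ≤ sum of the moduli of the entries; each entry ≤ the operator norm).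
* §2 `norm_frakGOfRecord_le_of_global`, `norm_H1OfRecord_le_of_global` — the (117) ∕ (103) sockets at the record: from the displayed
  `W`-level letters `hT` (value, constant `B₀`) and `hDT` (covariant gradient `covGrad (cRec F K k) (RRec F N U₀)`, constant `B₁`) of
  `frakGLatticeK hpos hQ` ∕ `H1LatticeK hpos hQ` to `‖frakGOfRecord …‖ ≤ max(w̄₀·N²B₀N², w̄₁·N²B₁N²)·w̲₃⁻¹` (resp. `·w̲_B⁻¹` for `H1OfRecord`),
  the weights `w̄`, `w̲` being `NegSup.wSup ∕ wInvSup` of the record's level profile `bondLevLit ∕ pairLevLit F Ω k` (resp. `levB`).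

## Honest labels

(1) BOOKKEEPING ONLY. The letters `hT`, `hDT` ARE the content of [B9] Thm 3.13 ∕ Thm 3.12 ∕ Thm 3.1 (3.47) at the record (the N06 ∕ NE9
leaves); they are DISPLAYED hypotheses here, as are `hpos` ([B9] Thm 3.11) and `hQ`; nothing of Bałaban's analysis is discharged.
(2) CRUDE CONSTANTS. Print's comparison is `‖X‖_op ≤ ‖X‖_tr` and `‖X‖_tr ≤ √N·‖X‖_op`; the `N²` of §1 are the one-line bounds and are
what the record's (117) carries until a sharper comparison is typed — they only rescale `B₀`, `B₁` (uniformly in the lattice, NOT in `N`).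
(3) The global (unweighted) sup letters are the `j = 0` reading of (117); the localised ∕ weighted letters of [B9] (3.47) with decay enter
through lit's `B11Eq117TransformationNorm.norm_toCLM115_le` ∕ `B11Eq117TransformationNormComp.norm_toCLM115_le_of_comp` roads (letters
`MT`, `MD` ∕ `MDT`), not instantiated here.
-/

noncomputable section

open scoped Matrix.Norms.L2Operator InnerProductSpace ComplexConjugate

namespace Literature.MathematicalPhysics.QuantumFieldTheory.Balaban1983to89.Node00

open T4Continuum (T4Family)
open B4Sect5Torus (TSite)
open B9SectCLatticeCarrier (Bond)
open B9Eq311L2Pairing (WL2)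
open B9Eq33CovDerivVector (covGrad)
open B9Eq310HessianOperator (adTransportW)
open B11Eq103H1Complex (SiteL2K BondL2K frakGLatticeK H1LatticeK)
open B11Eq111FrakG (nabla115)
open B11Eq115Space (Space115 NegSize NegSup levWeight)

/-! ## §1. The two normings of `M_N(ℂ)` compared along `phiRec` (crude constants `N²`) -/

section FibreNorms

variable {N : ℕ}

/-- A matrix unit `E_{pq}(c)` has operator norm `≤ ‖c‖`. [cite: Balaban1985Averaging, (18)–(19) p.21 (bookkeeping)] -/
private theorem l2_opNorm_single_le (p q : Fin N) (c : ℂ) : ‖Matrix.single p q c‖ ≤ ‖c‖ := by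
  set T := Matrix.toEuclideanCLM (n := Fin N) (𝕜 := ℂ) (Matrix.single p q c)
  rw [← Matrix.l2_opNorm_toEuclideanCLM]
  refine T.opNorm_le_bound (norm_nonneg c) fun y => ?_
  have hmv : ∀ w : Fin N → ℂ, Matrix.mulVec (Matrix.single p q c) w = Pi.single p (c * w q) := by
    intro w
    funext i
    simp only [Matrix.mulVec, dotProduct, Matrix.single_apply]
    by_cases hi : i = p
    · subst hi
      rw [Pi.single_eq_same, Finset.sum_eq_single q]
      · rw [if_pos ⟨rfl, rfl⟩]
      · intro j _ hj; rw [if_neg (fun h => hj h.2.symm), zero_mul]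
      · intro h; exact absurd (Finset.mem_univ _) h
    · rw [Pi.single_eq_of_ne hi]
      exact Finset.sum_eq_zero fun j _ => by rw [if_neg (fun h => hi h.1.symm), zero_mul]
  have hT : T y = EuclideanSpace.single p (c * y q) := by
    apply (WithLp.ofLp_injective (p := 2))
    rw [Matrix.ofLp_toEuclideanCLM, hmv]
    rfl
  rw [hT]
  calc ‖EuclideanSpace.single p (c * y q)‖ = ‖c * y q‖ := by simp
    _ = ‖c‖ * ‖y q‖ := norm_mul _ _
    _ ≤ ‖c‖ * ‖y‖ := mul_le_mul_of_nonneg_left (PiLp.norm_apply_le y q) (norm_nonneg c)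

/-- The operator norm is at most the sum of the entries' moduli. [cite: Balaban1985Averaging, (18)–(19) p.21 (bookkeeping)] -/
private theorem l2_opNorm_le_sum_norm_entry (M : Matrix (Fin N) (Fin N) ℂ) : ‖M‖ ≤ ∑ p, ∑ q, ‖M p q‖ := by
  conv_lhs => rw [Matrix.matrix_eq_sum_single M]
  exact (norm_sum_le _ _).trans (Finset.sum_le_sum fun p _ => (norm_sum_le _ _).trans
    (Finset.sum_le_sum fun q _ => l2_opNorm_single_le p q (M p q)))

/-- An entry is bounded by the operator norm (test against `e_j`). [cite: Balaban1985Averaging, (18)–(19) p.21 (bookkeeping)] -/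
private theorem norm_entry_le_l2_opNorm (A : Matrix (Fin N) (Fin N) ℂ) (i j : Fin N) : ‖A i j‖ ≤ ‖A‖ := by
  set v : EuclideanSpace ℂ (Fin N) := PiLp.single 2 j (1 : ℂ) with hv
  have hv1 : ‖v‖ = 1 := by rw [hv, PiLp.norm_single, norm_one]
  have h1 := Matrix.l2_opNorm_mulVec A v
  rw [hv1, mul_one] at h1
  have h2 : ‖((EuclideanSpace.equiv (Fin N) ℂ).symm (Matrix.mulVec A v.ofLp)) i‖ ≤
      ‖(EuclideanSpace.equiv (Fin N) ℂ).symm (Matrix.mulVec A v.ofLp)‖ := PiLp.norm_apply_le _ i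
  have h3 : ((EuclideanSpace.equiv (Fin N) ℂ).symm (Matrix.mulVec A v.ofLp)) i = A i j := by
    have : v.ofLp = Pi.single j 1 := by
      rw [hv]; rfl
    simp [this]
  rw [h3] at h2
  exact h2.trans h1

/-- **`‖φ v‖_op ≤ N²·‖v‖₂`**: the operator norm (19) of a matrix is dominated by the Euclidean norm (18) of its entries (crude constant:
operator norm ≤ sum of moduli of the entries, each ≤ the Euclidean norm). [cite: Balaban1985Averaging, (18)–(19) p.21] -/
theorem norm_phiRec_le (v : WRec N) : ‖phiRec N v‖ ≤ (N : ℝ) ^ 2 * ‖v‖ := by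
  refine (l2_opNorm_le_sum_norm_entry _).trans ?_
  calc ∑ p, ∑ q, ‖phiRec N v p q‖ ≤ ∑ _p : Fin N, ∑ _q : Fin N, ‖v‖ :=
        Finset.sum_le_sum fun p _ => Finset.sum_le_sum fun q _ => by
          rw [phiRec_apply]; exact PiLp.norm_apply_le v (p, q)
    _ = (N : ℝ) ^ 2 * ‖v‖ := by
        rw [Finset.sum_const, Finset.card_univ, Fintype.card_fin, Finset.sum_const, Finset.card_univ, Fintype.card_fin, smul_smul,
          nsmul_eq_mul, Nat.cast_mul, sq]

/-- **`‖φ⁻¹ X‖₂ ≤ N²·‖X‖_op`**: the Euclidean norm (18) of the entries is dominated by the operator norm (19) (crude constant: each entry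
`≤` the operator norm). [cite: Balaban1985Averaging, (18)–(19) p.21] -/
theorem norm_phiRec_symm_le (X : Matrix (Fin N) (Fin N) ℂ) : ‖(phiRec N).symm X‖ ≤ (N : ℝ) ^ 2 * ‖X‖ := by
  have hc : (Fintype.card (Fin N × Fin N) : ℝ) = (N : ℝ) ^ 2 := by
    rw [Fintype.card_prod, Fintype.card_fin, Nat.cast_mul, sq]
  have h0 : 0 ≤ (N : ℝ) ^ 2 * ‖X‖ := by positivity
  rw [← sq_le_sq₀ (norm_nonneg _) h0, PiLp.norm_sq_eq_of_L2]
  calc ∑ p : Fin N × Fin N, ‖(phiRec N).symm X p‖ ^ 2 ≤ ∑ _p : Fin N × Fin N, ‖X‖ ^ 2 :=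
        Finset.sum_le_sum fun p _ => by
          rw [phiRec_symm_apply]
          exact pow_le_pow_left₀ (norm_nonneg _) (norm_entry_le_l2_opNorm X p.1 p.2) 2
    _ = (N : ℝ) ^ 2 * ‖X‖ ^ 2 := by rw [Finset.sum_const, Finset.card_univ, nsmul_eq_mul, hc]
    _ ≤ ((N : ℝ) ^ 2 * ‖X‖) ^ 2 := by
        rw [mul_pow]
        refine mul_le_mul_of_nonneg_right ?_ (by positivity)
        have h1 : (N : ℝ) ^ 2 = ((N ^ 2 : ℕ) : ℝ) := by push_cast; ring
        rw [h1, ← Nat.cast_pow]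
        exact_mod_cast Nat.le_self_pow two_ne_zero (N ^ 2)

end FibreNorms

/-! ## §2. The (117) and (103) sockets AT THE RECORD: `W`-level sup letters of `𝔊`, `H₁` ⇒ operator-norm bounds of `frakGOfRecord`, `H1OfRecord` -/

section Sockets

open B11Eq115Space (NegSup levWeight)

variable {F : T4Family} {N : ℕ} {K : ℕ} {k : ℕ} {Ω : ℕ → Set (Site (F.P K) 0)} {U₀ : GaugeField (F.P K) 0 (SU N)}
  {β : Type*} [Fintype β] {wB : β → ℝ} [Fact (∀ y, 0 < wB y)] {F' : Type*} [AddCommGroup F'] [Module ℂ F']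
  [Fact (0 < (F.L : ℝ))] [Fact (0 < (F.P K).eta k)] [Fact (0 < c0Rec F K k)]
  {Q : BondL2K ℂ (F.P K).d (fun _ => (F.P K).sitesPerDir 0) (c0Rec F K k) (WRec N) →ₗ[ℂ] WL2 ℂ wB (WRec N)}
  {Q' : SiteL2K ℂ (F.P K).d (fun _ => (F.P K).sitesPerDir 0) (c0Rec F K k) (WRec N) →ₗ[ℂ] F'} {a : ℝ}
  (hpos : ∀ x, x ≠ 0 → 0 < RCLike.re ⟪x, laplaceAOfRecord F N k U₀ Q Q' a x⟫_ℂ) (hQ : Function.Surjective Q)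

/-- **THE (117) SOCKET AT THE RECORD**: global sup → sup letters of the Hilbert-level `𝔊 = frakGLatticeK hpos hQ` on the record's bond `L²` space —
value (`B₀`, [B9] Thm 3.13) and covariant gradient `∇_{U₀} = covGrad η_k⁻¹ R(U₀)` (`B₁`, [B9] (3.47)) — bound the (115)-operator norm of
`frakGOfRecord`: `‖𝔊(U₀)‖ ≤ max(w̄₀·N²B₀N², w̄₁·N²B₁N²)·w̲₃⁻¹` (crude fibre constants `N²` of §1; the weights are those of the record's level profile).
[cite: Balaban1985Variational, (117) p.295; Balaban1985BackgroundPropagators, Thm 3.13 p.426, Thm 3.1 (3.47) p.398] -/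
theorem norm_frakGOfRecord_le_of_global {B₀ B₁ : ℝ} (hB₀ : 0 ≤ B₀) (hB₁ : 0 ≤ B₁)
    (hT : ∀ (z : BondL2K ℂ (F.P K).d (fun _ => (F.P K).sitesPerDir 0) (c0Rec F K k) (WRec N)) (M : ℝ), 0 ≤ M →
      (∀ y, ‖WL2.equiv ℂ (fun _ : Bond (F.P K).d (fun _ => (F.P K).sitesPerDir 0) => c0Rec F K k) (WRec N) z y‖ ≤ M) →
      ∀ x, ‖WL2.equiv ℂ (fun _ : Bond (F.P K).d (fun _ => (F.P K).sitesPerDir 0) => c0Rec F K k) (WRec N) (frakGLatticeK hpos hQ z) x‖ ≤ B₀ * M)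
    (hDT : ∀ (z : BondL2K ℂ (F.P K).d (fun _ => (F.P K).sitesPerDir 0) (c0Rec F K k) (WRec N)) (M : ℝ), 0 ≤ M →
      (∀ y, ‖WL2.equiv ℂ (fun _ : Bond (F.P K).d (fun _ => (F.P K).sitesPerDir 0) => c0Rec F K k) (WRec N) z y‖ ≤ M) →
      ∀ p, ‖covGrad (cRec F K k) (RRec F N U₀)
        (WL2.equiv ℂ (fun _ : Bond (F.P K).d (fun _ => (F.P K).sitesPerDir 0) => c0Rec F K k) (WRec N) (frakGLatticeK hpos hQ z)) p‖ ≤ B₁ * M) :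
    ‖frakGOfRecord F N K k Ω U₀ Q Q' a hpos hQ‖ ≤
      max ((NegSup.wSup (levWeight (F.L : ℝ) ((F.P K).eta k) (bondLevLit F Ω k) 1) : ℝ) * ((N : ℝ) ^ 2 * B₀ * (N : ℝ) ^ 2))
          (NegSup.wSup (levWeight (F.L : ℝ) ((F.P K).eta k) (pairLevLit F Ω k) 2) * ((N : ℝ) ^ 2 * B₁ * (N : ℝ) ^ 2)) *
        NegSup.wInvSup (levWeight (F.L : ℝ) ((F.P K).eta k) (bondLevLit F Ω k) 3) :=
  B11Eq117ReadLettersBridge.norm_frakGLatticeCLM_le_of_global (phiRec N) hpos hQ (by positivity) norm_phiRec_le (by positivity)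
    norm_phiRec_symm_le ((F.P K).eta k) (unitsOfRecord F N U₀) (pairLevLit F Ω k) hB₀ hB₁ hT hDT

/-- **THE (103) SOCKET AT THE RECORD**: global sup → sup letters of `H₁ = H1LatticeK hpos hQ` (value `B₀`, [B9] Thm 3.12; covariant gradient `B₁`)
bound `‖H1OfRecord‖ ≤ max(w̄₀·N²B₀N², w̄₁·N²B₁N²)·w̲_B⁻¹`.
[cite: Balaban1985Variational, (103) p.293, (174) p.305; Balaban1985BackgroundPropagators, Thm 3.12 p.423, Thm 3.1 (3.47) p.398] -/
theorem norm_H1OfRecord_le_of_global (levB : β → ℕ) {B₀ B₁ : ℝ} (hB₀ : 0 ≤ B₀) (hB₁ : 0 ≤ B₁)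
    (hT : ∀ (z : WL2 ℂ wB (WRec N)) (M : ℝ), 0 ≤ M → (∀ y, ‖WL2.equiv ℂ wB (WRec N) z y‖ ≤ M) →
      ∀ x, ‖WL2.equiv ℂ (fun _ : Bond (F.P K).d (fun _ => (F.P K).sitesPerDir 0) => c0Rec F K k) (WRec N) (H1LatticeK hpos hQ z) x‖ ≤ B₀ * M)
    (hDT : ∀ (z : WL2 ℂ wB (WRec N)) (M : ℝ), 0 ≤ M → (∀ y, ‖WL2.equiv ℂ wB (WRec N) z y‖ ≤ M) →
      ∀ p, ‖covGrad (cRec F K k) (RRec F N U₀)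
        (WL2.equiv ℂ (fun _ : Bond (F.P K).d (fun _ => (F.P K).sitesPerDir 0) => c0Rec F K k) (WRec N) (H1LatticeK hpos hQ z)) p‖ ≤ B₁ * M) :
    ‖H1OfRecord F N K k Ω U₀ levB Q Q' a hpos hQ‖ ≤
      max ((NegSup.wSup (levWeight (F.L : ℝ) ((F.P K).eta k) (bondLevLit F Ω k) 1) : ℝ) * ((N : ℝ) ^ 2 * B₀ * (N : ℝ) ^ 2))
          (NegSup.wSup (levWeight (F.L : ℝ) ((F.P K).eta k) (pairLevLit F Ω k) 2) * ((N : ℝ) ^ 2 * B₁ * (N : ℝ) ^ 2)) *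
        NegSup.wInvSup (levWeight (F.L : ℝ) ((F.P K).eta k) levB 0) :=
  B11Eq117ReadLettersBridge.norm_H1LatticeCLM_le_of_global (phiRec N) hpos hQ (by positivity) norm_phiRec_le (by positivity)
    norm_phiRec_symm_le ((F.P K).eta k) (unitsOfRecord F N U₀) (pairLevLit F Ω k) hB₀ hB₁ hT hDT

end Sockets

end Literature.MathematicalPhysics.QuantumFieldTheory.Balaban1983to89.Node00

end
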